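import Literature.Analysis.FluidPDE.PeriodicLerayExistence
import Literature.Analysis.FluidPDE.PeriodicLerayProfilePotential
import Literature.Analysis.FluidPDE.BiotSavartBounds
import HarnessLib

/-!
# [BT1] proof of Lemma 2.5, the gradient bound: discharge of
  `bradshawTsai2017_lemma_2_5_gradient`

Analysis/FluidPDE proof file (theorems only) discharging the named fact
`Literature.Analysis.FluidPDE.bradshawTsai2017_lemma_2_5_gradient` of `PeriodicLerayExistence.lean`
(Bradshaw–Tsai, Ann. Henri Poincaré 18 (2017) = arXiv:1510.07504 [BT1], proof of Lemma 2.5):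
for a profile `U₀` under Assumption 2.1 and every `R₀ ≥ 1`, the revised profile
`W = ξU₀ + w` (`BradshawTsai2017.revisedProfile R₀ U₀`, `ξ = ξ_{R₀}`,
`w(y) = −∫ (∇ξ·U₀)(z) ∇Γ(y − z) dz`) satisfies `sup_s ∫ |∇U₀(s) − ∇W(s)|² < ∞`.

## The argument

[BT1] (proof of Lemma 2.5, p. 8 of the arXiv version) write, for `|y| ≤ 4R₀`,
"`∇w(y) = ∫ ∇_y (4π|y−z|)⁻¹ ∇_z(∇_zξ(z)·U₀(z)) dz`, and, since `U₀` is continuously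
differentiable we have `‖∇U₀‖_{L^∞(B_{2R₀})} < ∞` and thus `‖∇w‖_{L^∞(B_{4R₀})} ≤ C(R₀,U₀)`",
and for `|y| ≥ 4R₀` they move both derivatives onto the kernel to get `|∇w(y)| ≲ |y|⁻³`. The
statement to be proved only needs `∇w(s) ∈ L²` uniformly in `s`, for which the first formula
suffices **for all `y`**: with `φ_s = ∇ξ·U₀(s) ∈ C¹_c(B̄_{2R₀})` and `∇Γ ∈ L¹_loc(ℝ³)`,
`|∇Γ(x)| ≤ (4π|x|²)⁻¹`,

* `Dw(s) = −(Dφ_s) ⋆ ∇Γ` everywhere (Mathlib's `HasCompactSupport.hasFDerivAt_convolution_left`;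
  `hasFDerivAt_profileCorrector`);
* `‖Dw(s)(y)‖ ≤ ∫_{B̄_{2R₀}} M (4π|y − t|²)⁻¹ dt ≤ A (1 + |y|)⁻²` with `M = sup |Dφ_s|` — the sup
  bound `5M(2R₀)` and the far-field bound `(4/3)M(2R₀)³|y|⁻²` are those of the tree's
  `BiotSavartBounds` (Majda–Bertozzi Lemma 4.5), written here for an arbitrary integrand
  dominated by `(4π)⁻¹|ω(t)| |y − t|⁻²` (`norm_integral_le_bracket_of_kernel_bound`);
* `D(U₀(s)) − D(ξU₀(s))` vanishes off `B̄_{2R₀}` (`ξ = 1` there) and is bounded on it;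
* all constants are uniform in `s`: by `T`-periodicity it suffices to take `s ∈ [0,T]`, and
  `DU₀`, `D(ξU₀)`, `Dφ` are continuous on the compact `[0,T] × B̄_{2R₀}` (`U₀ ∈ C¹(ℝ × ℝ³)`);
* `|L|² ≤ 3‖L‖²` for the Frobenius norm and `∫ (1 + |y|)⁻⁴ dy < ∞` in `ℝ³`
  (Mathlib `finite_integral_one_add_norm`).

## Mathlib / tree search

Reused: `revisedProfile`, `profileCorrector`, `cutoffScaled(_eq_one)`, `contDiff_cutoffScaled`,
`ProfileAssumption`, `frobeniusNormSq` (`PeriodicLerayExistence`, `PeriodicLeraySystem`,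
`VectorCalculus`); `newtonKernel` (`NewtonKernel`); `locallyIntegrable_gradient_newtonKernel`,
`norm_gradient_newtonKernel_le` (`PeriodicLerayProfilePotential`, namespace `NewtonGradPotential`);
`kernelMajorant`, `lintegral_majorant_le`, `norm_sub_sq_inv_le_kernelMajorant_add`
(`BiotSavartBounds`). Mathlib: `HasCompactSupport.hasFDerivAt_convolution_left`,
`Function.Periodic.exists_mem_Ico₀`, `IsCompact.exists_bound_of_continuousOn`,
`finite_integral_one_add_norm`. `lean search 'profileCorrector|revisedProfile'`: no prior
derivative computations for the corrector.

## References

* Z. Bradshaw, T.-P. Tsai, *Forward discretely self-similar solutions of the Navier–Stokes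
  equations II*, Ann. Henri Poincaré 18 (2017) 1095–1119 = arXiv:1510.07504, Lemma 2.5 and its
  proof (the bound on `∇w`) [BradshawTsai2017AHP].
* A. J. Majda, A. L. Bertozzi, *Vorticity and Incompressible Flow* (CUP 2002), Lemma 4.5
  [MajdaBertozziCUP2002].
-/

noncomputable section

open MeasureTheory Set Function Filter Topology TopologicalSpace Metric Module Real
open scoped NNReal ENNReal InnerProductSpace RealInnerProductSpace Convolution

namespace Literature.Analysis.FluidPDE

namespace BradshawTsai2017

open NewtonGradPotential (locallyIntegrable_gradient_newtonKernel norm_gradient_newtonKernel_le)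

/-! ### Generalities: Frobenius versus operator norm, slices of jointly `C¹` maps -/

/-- `|L|² ≤ 3‖L‖²` for the Frobenius norm on `ℝ³` (each `‖L eᵢ‖ ≤ ‖L‖`). [folklore] -/
theorem frobeniusNormSq_le_three_mul_norm_sq
    (L : EuclideanSpace ℝ (Fin 3) →L[ℝ] EuclideanSpace ℝ (Fin 3)) :
    frobeniusNormSq L ≤ 3 * ‖L‖ ^ 2 := by
  unfold frobeniusNormSq
  calc ∑ i, ‖L (stdOrthonormalBasis ℝ (EuclideanSpace ℝ (Fin 3)) i)‖ ^ 2
      ≤ ∑ _i : Fin (finrank ℝ (EuclideanSpace ℝ (Fin 3))), ‖L‖ ^ 2 := by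
        refine Finset.sum_le_sum fun i _ => ?_
        have h := L.le_opNorm (stdOrthonormalBasis ℝ (EuclideanSpace ℝ (Fin 3)) i)
        rw [(stdOrthonormalBasis ℝ (EuclideanSpace ℝ (Fin 3))).orthonormal.1 i, mul_one] at h
        exact pow_le_pow_left₀ (norm_nonneg _) h 2
    _ = 3 * ‖L‖ ^ 2 := by
        rw [Finset.sum_const, Finset.card_univ, Fintype.card_fin, finrank_euclideanSpace_fin,
          nsmul_eq_mul]
        norm_num

/-- The slice `G(s, ·)` of a jointly `C¹` map has derivative `DG(s,y) ∘ (0, ·)`. [folklore] -/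
theorem hasFDerivAt_timeSlice {F : Type*} [NormedAddCommGroup F] [NormedSpace ℝ F]
    {G : ℝ → EuclideanSpace ℝ (Fin 3) → F} (hG : ContDiff ℝ 1 (uncurry G)) (s : ℝ)
    (y : EuclideanSpace ℝ (Fin 3)) :
    HasFDerivAt (G s) ((fderiv ℝ (uncurry G) (s, y)).comp
      (ContinuousLinearMap.inr ℝ ℝ (EuclideanSpace ℝ (Fin 3)))) y :=
  ((hG.differentiable one_ne_zero) (s, y)).hasFDerivAt.comp y (hasFDerivAt_prodMk_right s y)

/-- The derivative of a slice is bounded by the total derivative: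
`‖D(G(s,·))(y)‖ ≤ ‖DG(s,y)‖`. [folklore] -/
theorem norm_fderiv_timeSlice_le {F : Type*} [NormedAddCommGroup F] [NormedSpace ℝ F]
    {G : ℝ → EuclideanSpace ℝ (Fin 3) → F} (hG : ContDiff ℝ 1 (uncurry G)) (s : ℝ)
    (y : EuclideanSpace ℝ (Fin 3)) :
    ‖fderiv ℝ (G s) y‖ ≤ ‖fderiv ℝ (uncurry G) (s, y)‖ := by
  rw [(hasFDerivAt_timeSlice hG s y).fderiv]
  refine ContinuousLinearMap.opNorm_le_bound _ (norm_nonneg _) fun v => ?_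
  rw [ContinuousLinearMap.comp_apply, ContinuousLinearMap.inr_apply]
  refine (ContinuousLinearMap.le_opNorm _ _).trans (le_of_eq ?_)
  rw [Prod.norm_mk, norm_zero, max_eq_right (norm_nonneg _)]

/-! ### The potential `y ↦ −∫ ψ(z) ∇Γ(y − z) dz` of a `C¹_c` density: its derivative -/

/-- **Differentiating the potential `y ↦ −∫ ψ(z) ∇Γ(y − z) dz` of a `C¹_c` density**: the
derivative falls on the density, `D(−ψ ⋆ ∇Γ) = −(Dψ) ⋆ ∇Γ` (Mathlib's
`HasCompactSupport.hasFDerivAt_convolution_left` with `∇Γ ∈ L¹_loc`; [BT1] proof of Lemma 2.5: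
"`∇w(y) = ∫ ∇_y(4π|y−z|)⁻¹ ∇_z(∇_zξ(z)·U₀(z)) dz`"). [cite: BradshawTsai2017AHP, proof of Lemma 2.5 (the bound on ∇w)] -/
theorem hasFDerivAt_gradNewtonPotential {ψ : EuclideanSpace ℝ (Fin 3) → ℝ} (hψ : ContDiff ℝ 1 ψ)
    (hψc : HasCompactSupport ψ) (y : EuclideanSpace ℝ (Fin 3)) :
    HasFDerivAt (fun y => -∫ z, ψ z • gradient newtonKernel (y - z))
      (-(fderiv ℝ ψ ⋆[(ContinuousLinearMap.lsmul ℝ ℝ :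
        ℝ →L[ℝ] EuclideanSpace ℝ (Fin 3) →L[ℝ] EuclideanSpace ℝ (Fin 3)).precompL
          (EuclideanSpace ℝ (Fin 3)), volume] gradient newtonKernel) y) y := by
  have h := hψc.hasFDerivAt_convolution_left
    (ContinuousLinearMap.lsmul ℝ ℝ :
        ℝ →L[ℝ] EuclideanSpace ℝ (Fin 3) →L[ℝ] EuclideanSpace ℝ (Fin 3)) hψ
    locallyIntegrable_gradient_newtonKernel y
  have e : (fun y => -∫ z, ψ z • gradient newtonKernel (y - z)) =
      -(ψ ⋆[(ContinuousLinearMap.lsmul ℝ ℝ :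
        ℝ →L[ℝ] EuclideanSpace ℝ (Fin 3) →L[ℝ] EuclideanSpace ℝ (Fin 3)), volume]
        gradient newtonKernel) := by
    funext y
    rw [Pi.neg_apply, convolution_lsmul]
  rw [e]
  exact h.neg

/-- The integrand of `(Dψ) ⋆ ∇Γ` is dominated by `(4π)⁻¹ ‖Dψ(t)‖ |y − t|⁻²`
(`‖∇Γ(x)‖ ≤ (4π|x|²)⁻¹`, `NewtonGradPotential.norm_gradient_newtonKernel_le`). [folklore] -/
theorem norm_precompL_lsmul_gradient_newtonKernel_le (A : EuclideanSpace ℝ (Fin 3) →L[ℝ] ℝ)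
    (y t : EuclideanSpace ℝ (Fin 3)) :
    ‖(ContinuousLinearMap.lsmul ℝ ℝ :
        ℝ →L[ℝ] EuclideanSpace ℝ (Fin 3) →L[ℝ] EuclideanSpace ℝ (Fin 3)).precompL
          (EuclideanSpace ℝ (Fin 3)) A (gradient newtonKernel (y - t))‖ ≤
      (4 * π)⁻¹ * ‖A‖ * (‖y - t‖ ^ 2)⁻¹ := by
  refine (ContinuousLinearMap.le_opNorm₂ _ A _).trans ?_
  have h1 : ‖(ContinuousLinearMap.lsmul ℝ ℝ :
      ℝ →L[ℝ] EuclideanSpace ℝ (Fin 3) →L[ℝ] EuclideanSpace ℝ (Fin 3)).precompL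
        (EuclideanSpace ℝ (Fin 3))‖ ≤ 1 :=
    (ContinuousLinearMap.norm_precompL_le _ _).trans ContinuousLinearMap.opNorm_lsmul_le
  have h2 := norm_gradient_newtonKernel_le (y - t)
  calc ‖(ContinuousLinearMap.lsmul ℝ ℝ :
        ℝ →L[ℝ] EuclideanSpace ℝ (Fin 3) →L[ℝ] EuclideanSpace ℝ (Fin 3)).precompL
          (EuclideanSpace ℝ (Fin 3))‖ * ‖A‖ * ‖gradient newtonKernel (y - t)‖
      ≤ 1 * ‖A‖ * (4 * π * ‖y - t‖ ^ 2)⁻¹ := by gcongr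
    _ = (4 * π)⁻¹ * ‖A‖ * (‖y - t‖ ^ 2)⁻¹ := by rw [one_mul, mul_inv]; ring

/-! ### Integrals dominated by `(4π)⁻¹ |ω(t)| |y − t|⁻²` with `ω` bounded and supported in a
ball: sup bound, far-field decay, Japanese-bracket majorant (the estimates of `BiotSavartBounds`,
Majda–Bertozzi Lemma 4.5, for a general integrand) -/

section KernelBounds

variable {X W : Type*} [NormedAddCommGroup X] [NormedSpace ℝ X] [NormedAddCommGroup W]
  {ω : EuclideanSpace ℝ (Fin 3) → W} {ρ M : ℝ}
  {Φ : EuclideanSpace ℝ (Fin 3) → EuclideanSpace ℝ (Fin 3) → X}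

omit [NormedSpace ℝ X] in
/-- Pointwise bound of an integrand dominated by `(4π)⁻¹|ω(t)| |y − t|⁻²`, `|ω| ≤ M`,
`supp ω ⊆ B̄(0, ρ)`, by the split majorant
`(4π)⁻¹ M (1_{|y−t|<4ρ} |y − t|⁻² + (16ρ²)⁻¹ 1_{B̄(0,ρ)}(t))` (cf.
`norm_biotSavartKernel_apply_le_majorant`). [folklore] -/
theorem norm_le_majorant_of_kernel_bound (hρ : 0 < ρ) (hM : ∀ t, ‖ω t‖ ≤ M)
    (hsupp : support ω ⊆ closedBall 0 ρ)
    (hΦ : ∀ y t, t ≠ y → ‖Φ y t‖ ≤ (4 * π)⁻¹ * ‖ω t‖ * (‖y - t‖ ^ 2)⁻¹)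
    {y t : EuclideanSpace ℝ (Fin 3)} (hty : t ≠ y) :
    ‖Φ y t‖ ≤ (4 * π)⁻¹ * M * (kernelMajorant (4 * ρ) (y - t) +
        (16 * ρ ^ 2)⁻¹ *
          (closedBall (0 : EuclideanSpace ℝ (Fin 3)) ρ).indicator (fun _ => (1 : ℝ)) t) := by
  have hM0 : 0 ≤ M := (norm_nonneg _).trans (hM t)
  by_cases ht : t ∈ closedBall (0 : EuclideanSpace ℝ (Fin 3)) ρ
  · rw [indicator_of_mem ht, mul_one]
    calc ‖Φ y t‖ ≤ (4 * π)⁻¹ * ‖ω t‖ * (‖y - t‖ ^ 2)⁻¹ := hΦ y t hty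
      _ ≤ (4 * π)⁻¹ * M * (‖y - t‖ ^ 2)⁻¹ := by gcongr; exact hM t
      _ ≤ (4 * π)⁻¹ * M * (kernelMajorant (4 * ρ) (y - t) + (16 * ρ ^ 2)⁻¹) := by
          gcongr
          exact norm_sub_sq_inv_le_kernelMajorant_add hρ y t
  · have hω : ω t = 0 := by
      by_contra h
      exact ht (hsupp (mem_support.2 h))
    have h0 : ‖Φ y t‖ ≤ 0 := by
      have h1 := hΦ y t hty
      rw [hω, norm_zero, mul_zero, zero_mul] at h1
      exact h1
    rw [indicator_of_notMem ht, mul_zero, add_zero]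
    exact h0.trans (mul_nonneg (by positivity) (kernelMajorant_nonneg _ _))

/-- **Sup bound** (Majda–Bertozzi Lemma 4.5 for a dominated integrand): `‖∫ Φ(y,t) dt‖ ≤ 5Mρ`
(integrate the split majorant, `lintegral_majorant_le`; the exceptional point `t = y` is
null). [cite: MajdaBertozziCUP2002, §4.1.3 Lemma 4.5 (4.34)] -/
theorem norm_integral_le_of_kernel_bound (hρ : 0 < ρ) (hM : ∀ t, ‖ω t‖ ≤ M)
    (hsupp : support ω ⊆ closedBall 0 ρ)
    (hΦ : ∀ y t, t ≠ y → ‖Φ y t‖ ≤ (4 * π)⁻¹ * ‖ω t‖ * (‖y - t‖ ^ 2)⁻¹)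
    (y : EuclideanSpace ℝ (Fin 3)) : ‖∫ t, Φ y t‖ ≤ 5 * M * ρ := by
  have hM0 : 0 ≤ M := (norm_nonneg _).trans (hM 0)
  have h1 : ‖∫ t, Φ y t‖ₑ ≤ ENNReal.ofReal (5 * M * ρ) := by
    refine (enorm_integral_le_lintegral_enorm _).trans ?_
    refine (lintegral_mono_ae ?_).trans
      (lintegral_majorant_le (x₀ := (0 : EuclideanSpace ℝ (Fin 3))) hρ hM0 y)
    filter_upwards [compl_mem_ae_iff.2 (measure_singleton y)] with t ht
    have hty : t ≠ y := fun h => ht (mem_singleton_iff.2 h)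
    rw [← ofReal_norm]
    exact ENNReal.ofReal_le_ofReal (norm_le_majorant_of_kernel_bound hρ hM hsupp hΦ hty)
  rw [← ofReal_norm] at h1
  exact (ENNReal.ofReal_le_ofReal_iff (by positivity)).1 h1

/-- **Far-field decay**: for `2ρ ≤ |y|`, `‖∫ Φ(y,t) dt‖ ≤ (4/3) M ρ³ |y|⁻²` (on the support
`|y − t| ≥ |y| − ρ ≥ |y|/2`, and `|B̄_ρ| = 4πρ³/3`). [folklore] -/
theorem norm_integral_le_of_kernel_bound_far (hρ : 0 < ρ) (hM : ∀ t, ‖ω t‖ ≤ M)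
    (hsupp : support ω ⊆ closedBall 0 ρ)
    (hΦ : ∀ y t, t ≠ y → ‖Φ y t‖ ≤ (4 * π)⁻¹ * ‖ω t‖ * (‖y - t‖ ^ 2)⁻¹)
    {y : EuclideanSpace ℝ (Fin 3)} (hy : 2 * ρ ≤ ‖y‖) :
    ‖∫ t, Φ y t‖ ≤ 4 / 3 * M * ρ ^ 3 * (‖y‖ ^ 2)⁻¹ := by
  have hM0 : 0 ≤ M := (norm_nonneg _).trans (hM 0)
  have hd : 0 < ‖y‖ := by nlinarith
  set c : ℝ := (4 * π)⁻¹ * M * (4 * (‖y‖ ^ 2)⁻¹) with hc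
  have hc0 : 0 ≤ c := by positivity
  have hpt : ∀ t, t ≠ y → ‖Φ y t‖ ≤
      c * (closedBall (0 : EuclideanSpace ℝ (Fin 3)) ρ).indicator (fun _ => (1 : ℝ)) t := by
    intro t hty
    by_cases ht : t ∈ closedBall (0 : EuclideanSpace ℝ (Fin 3)) ρ
    · rw [indicator_of_mem ht, mul_one]
      have hyt : ‖y‖ / 2 ≤ ‖y - t‖ := by
        have h1 : ‖y‖ ≤ ‖t‖ + ‖y - t‖ := norm_le_insert' y t
        rw [mem_closedBall, dist_zero_right] at ht
        linarith
      have hinv : (‖y - t‖ ^ 2)⁻¹ ≤ 4 * (‖y‖ ^ 2)⁻¹ := by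
        have hpos : 0 < (‖y‖ / 2) ^ 2 := by positivity
        calc (‖y - t‖ ^ 2)⁻¹ ≤ ((‖y‖ / 2) ^ 2)⁻¹ :=
              inv_anti₀ hpos (pow_le_pow_left₀ (by positivity) hyt 2)
          _ = 4 * (‖y‖ ^ 2)⁻¹ := by
              field_simp
              ring
      calc ‖Φ y t‖ ≤ (4 * π)⁻¹ * ‖ω t‖ * (‖y - t‖ ^ 2)⁻¹ := hΦ y t hty
        _ ≤ (4 * π)⁻¹ * M * (4 * (‖y‖ ^ 2)⁻¹) := by gcongr; exact hM t
    · have hω : ω t = 0 := by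
        by_contra h
        exact ht (hsupp (mem_support.2 h))
      have h0 : ‖Φ y t‖ ≤ 0 := by
        have h1 := hΦ y t hty
        rw [hω, norm_zero, mul_zero, zero_mul] at h1
        exact h1
      rw [indicator_of_notMem ht, mul_zero]
      exact h0
  have h1 : ‖∫ t, Φ y t‖ₑ ≤ ENNReal.ofReal (4 / 3 * M * ρ ^ 3 * (‖y‖ ^ 2)⁻¹) := by
    refine (enorm_integral_le_lintegral_enorm _).trans ?_
    have h2 : ∫⁻ t, ‖Φ y t‖ₑ ≤ ∫⁻ t, ENNReal.ofReal c *
        (closedBall (0 : EuclideanSpace ℝ (Fin 3)) ρ).indicator (fun _ => (1 : ℝ≥0∞)) t := by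
      refine lintegral_mono_ae ?_
      filter_upwards [compl_mem_ae_iff.2 (measure_singleton y)] with t ht
      have hty : t ≠ y := fun h => ht (mem_singleton_iff.2 h)
      rw [← ofReal_norm]
      refine (ENNReal.ofReal_le_ofReal (hpt t hty)).trans ?_
      by_cases ht' : t ∈ closedBall (0 : EuclideanSpace ℝ (Fin 3)) ρ
      · rw [indicator_of_mem ht', indicator_of_mem ht', mul_one, mul_one]
      · rw [indicator_of_notMem ht', indicator_of_notMem ht', mul_zero, mul_zero,
          ENNReal.ofReal_zero]
    refine h2.trans ?_
    rw [lintegral_const_mul _ (measurable_const.indicator measurableSet_closedBall),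
      lintegral_indicator measurableSet_closedBall, setLIntegral_const, one_mul,
      EuclideanSpace.volume_closedBall_fin_three, ← ENNReal.ofReal_pow hρ.le,
      ← ENNReal.ofReal_mul (by positivity), ← ENNReal.ofReal_mul hc0]
    refine ENNReal.ofReal_le_ofReal (le_of_eq ?_)
    rw [hc]
    field_simp
  rw [← ofReal_norm] at h1
  exact (ENNReal.ofReal_le_ofReal_iff (by positivity)).1 h1

/-- **A global majorant with Japanese-bracket decay**: `‖∫ Φ(y,t) dt‖ ≤ A (1 + |y|)⁻²` for all
`y`, `A = max (5Mρ(1 + 2ρ)²) ((4/3)Mρ³(1 + (2ρ)⁻¹)²)` (sup bound inside `|y| < 2ρ`, decay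
outside; cf. `norm_biotSavart_le_bracket`). [folklore] -/
theorem norm_integral_le_bracket_of_kernel_bound (hρ : 0 < ρ) (hM : ∀ t, ‖ω t‖ ≤ M)
    (hsupp : support ω ⊆ closedBall 0 ρ)
    (hΦ : ∀ y t, t ≠ y → ‖Φ y t‖ ≤ (4 * π)⁻¹ * ‖ω t‖ * (‖y - t‖ ^ 2)⁻¹)
    (y : EuclideanSpace ℝ (Fin 3)) :
    ‖∫ t, Φ y t‖ ≤
      max (5 * M * ρ * (1 + 2 * ρ) ^ 2) (4 / 3 * M * ρ ^ 3 * (1 + (2 * ρ)⁻¹) ^ 2) *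
        ((1 + ‖y‖) ^ 2)⁻¹ := by
  have hM0 : 0 ≤ M := (norm_nonneg _).trans (hM 0)
  set d : ℝ := ‖y‖ with hd
  have hd0 : 0 ≤ d := norm_nonneg _
  rcases le_or_gt (2 * ρ) d with hfar | hnear
  · have hdpos : 0 < d := by linarith
    have h1 := norm_integral_le_of_kernel_bound_far hρ hM hsupp hΦ (y := y) hfar
    refine h1.trans ?_
    rw [← hd]
    have hratio : (1 + d) * d⁻¹ ≤ 1 + (2 * ρ)⁻¹ := by
      rw [add_mul, mul_inv_cancel₀ hdpos.ne', one_mul, add_comm]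
      gcongr
    have hratio0 : 0 ≤ (1 + d) * d⁻¹ := by positivity
    have key : (d ^ 2)⁻¹ ≤ (1 + (2 * ρ)⁻¹) ^ 2 * ((1 + d) ^ 2)⁻¹ := by
      have h2 : (d ^ 2)⁻¹ = ((1 + d) * d⁻¹) ^ 2 * ((1 + d) ^ 2)⁻¹ := by
        field_simp
      rw [h2]
      exact mul_le_mul_of_nonneg_right (pow_le_pow_left₀ hratio0 hratio 2) (by positivity)
    calc 4 / 3 * M * ρ ^ 3 * (d ^ 2)⁻¹
        ≤ 4 / 3 * M * ρ ^ 3 * ((1 + (2 * ρ)⁻¹) ^ 2 * ((1 + d) ^ 2)⁻¹) :=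
          mul_le_mul_of_nonneg_left key (by positivity)
      _ = 4 / 3 * M * ρ ^ 3 * (1 + (2 * ρ)⁻¹) ^ 2 * ((1 + d) ^ 2)⁻¹ := by ring
      _ ≤ _ := mul_le_mul_of_nonneg_right (le_max_right _ _) (by positivity)
  · have h1 := norm_integral_le_of_kernel_bound hρ hM hsupp hΦ y
    refine h1.trans ?_
    have key : (1 : ℝ) ≤ (1 + 2 * ρ) ^ 2 * ((1 + d) ^ 2)⁻¹ := by
      rw [← div_eq_mul_inv, one_le_div (by positivity)]
      exact pow_le_pow_left₀ (by positivity) (by linarith) 2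
    calc 5 * M * ρ = 5 * M * ρ * 1 := (mul_one _).symm
      _ ≤ 5 * M * ρ * ((1 + 2 * ρ) ^ 2 * ((1 + d) ^ 2)⁻¹) :=
          mul_le_mul_of_nonneg_left key (by positivity)
      _ = 5 * M * ρ * (1 + 2 * ρ) ^ 2 * ((1 + d) ^ 2)⁻¹ := by ring
      _ ≤ _ := mul_le_mul_of_nonneg_right (le_max_left _ _) (by positivity)

end KernelBounds

/-! ### The density `φ = ∇ξ_R · u` of the corrector and the cut-off part `ξ_R u` -/

/-- `∇ξ_R(z) = 0` for `|z| > 2R` (`ξ_R = 1` on `|z| ≥ 2R`). [cite: BradshawTsai2017AHP, §2 before Lemma 2.5] -/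
theorem gradient_cutoffScaled_eq_zero {R : ℝ} (hR : 0 < R) {z : EuclideanSpace ℝ (Fin 3)}
    (hz : 2 * R < ‖z‖) : gradient (cutoffScaled R) z = 0 := by
  have h : cutoffScaled R =ᶠ[𝓝 z] fun _ => (1 : ℝ) := by
    filter_upwards [(isOpen_lt continuous_const continuous_norm).mem_nhds hz] with x hx
    exact cutoffScaled_eq_one hR hx.le
  rw [gradient, h.fderiv_eq, fderiv_const_apply, map_zero]

/-- `∇ξ_R` is `C¹` (`ξ_R` is smooth). [cite: BradshawTsai2017AHP, §2 before Lemma 2.5] -/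
theorem contDiff_gradient_cutoffScaled (R : ℝ) : ContDiff ℝ 1 (gradient (cutoffScaled R)) := by
  have e : gradient (cutoffScaled R) = fun x =>
      (InnerProductSpace.toDual ℝ (EuclideanSpace ℝ (Fin 3))).symm (fderiv ℝ (cutoffScaled R) x) :=
    rfl
  rw [e]
  have h2 : ContDiff ℝ 2 (cutoffScaled R) := contDiff_cutoffScaled R
  exact (InnerProductSpace.toDual ℝ (EuclideanSpace ℝ (Fin 3))).symm.contDiff.comp
    (h2.fderiv_right le_rfl)

/-- The density `(s, z) ↦ ∇ξ_R(z) · U₀(s, z)` is jointly `C¹` for `U₀ ∈ C¹(ℝ × ℝ³)`. [folklore] -/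
theorem contDiff_cutoffGradDensity {U₀ : ℝ → EuclideanSpace ℝ (Fin 3) → EuclideanSpace ℝ (Fin 3)}
    (hU : ContDiff ℝ 1 (uncurry U₀)) (R : ℝ) :
    ContDiff ℝ 1 (uncurry fun s z => ⟪gradient (cutoffScaled R) z, U₀ s z⟫) :=
  ((contDiff_gradient_cutoffScaled R).comp contDiff_snd).inner ℝ hU

/-- The cut-off profile `(s, y) ↦ ξ_R(y) U₀(s, y)` is jointly `C¹`. [folklore] -/
theorem contDiff_cutoffScaled_smul {U₀ : ℝ → EuclideanSpace ℝ (Fin 3) → EuclideanSpace ℝ (Fin 3)}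
    (hU : ContDiff ℝ 1 (uncurry U₀)) (R : ℝ) :
    ContDiff ℝ 1 (uncurry fun s y => cutoffScaled R y • U₀ s y) :=
  ((contDiff_cutoffScaled R).comp contDiff_snd).smul hU

/-- The density `∇ξ_R · u` of a slice vanishes for `|z| > 2R`. [folklore] -/
theorem cutoffGradDensity_eq_zero {R : ℝ} (hR : 0 < R)
    (u : EuclideanSpace ℝ (Fin 3) → EuclideanSpace ℝ (Fin 3)) {z : EuclideanSpace ℝ (Fin 3)}
    (hz : 2 * R < ‖z‖) : ⟪gradient (cutoffScaled R) z, u z⟫ = 0 := by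
  rw [gradient_cutoffScaled_eq_zero hR hz, inner_zero_left]

/-- The density `∇ξ_R · u` has compact support (in `B̄(0, 2R)`). [folklore] -/
theorem hasCompactSupport_cutoffGradDensity {R : ℝ} (hR : 0 < R)
    (u : EuclideanSpace ℝ (Fin 3) → EuclideanSpace ℝ (Fin 3)) :
    HasCompactSupport fun z => ⟪gradient (cutoffScaled R) z, u z⟫ := by
  refine HasCompactSupport.intro (isCompact_closedBall (0 : EuclideanSpace ℝ (Fin 3)) (2 * R))
    fun z hz => ?_
  rw [mem_closedBall, dist_zero_right, not_le] at hz
  exact cutoffGradDensity_eq_zero hR u hz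

/-- The derivative of the density vanishes for `|z| > 2R`. [folklore] -/
theorem fderiv_cutoffGradDensity_eq_zero {R : ℝ} (hR : 0 < R)
    (u : EuclideanSpace ℝ (Fin 3) → EuclideanSpace ℝ (Fin 3)) {z : EuclideanSpace ℝ (Fin 3)}
    (hz : 2 * R < ‖z‖) :
    fderiv ℝ (fun z => ⟪gradient (cutoffScaled R) z, u z⟫) z = 0 := by
  have h : (fun z => ⟪gradient (cutoffScaled R) z, u z⟫) =ᶠ[𝓝 z] fun _ => (0 : ℝ) := by
    filter_upwards [(isOpen_lt continuous_const continuous_norm).mem_nhds hz] with x hx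
    exact cutoffGradDensity_eq_zero hR u hx
  rw [h.fderiv_eq, fderiv_const_apply]

/-- The derivative of the density of a slice is supported in `B̄(0, 2R)`. [folklore] -/
theorem support_fderiv_cutoffGradDensity_subset {R : ℝ} (hR : 0 < R)
    (u : EuclideanSpace ℝ (Fin 3) → EuclideanSpace ℝ (Fin 3)) :
    support (fderiv ℝ fun z => ⟪gradient (cutoffScaled R) z, u z⟫) ⊆
      closedBall (0 : EuclideanSpace ℝ (Fin 3)) (2 * R) := by
  intro t ht
  rw [mem_closedBall, dist_zero_right]
  by_contra h
  exact ht (fderiv_cutoffGradDensity_eq_zero hR u (not_le.1 h))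

/-- Off `B̄(0, 2R)` the cut-off does not change the derivative: `D(ξ_R u)(y) = Du(y)` for
`|y| > 2R`. [folklore] -/
theorem fderiv_cutoffScaled_smul_eq {R : ℝ} (hR : 0 < R)
    (u : EuclideanSpace ℝ (Fin 3) → EuclideanSpace ℝ (Fin 3)) {y : EuclideanSpace ℝ (Fin 3)}
    (hy : 2 * R < ‖y‖) : fderiv ℝ (fun y => cutoffScaled R y • u y) y = fderiv ℝ u y := by
  refine Filter.EventuallyEq.fderiv_eq ?_
  filter_upwards [(isOpen_lt continuous_const continuous_norm).mem_nhds hy] with x hx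
  rw [cutoffScaled_eq_one hR hx.le, one_smul]

/-! ### The derivative of the corrector `w` and of the revised profile `W` -/

/-- **`w(s) = profileCorrector R U₀ s` is differentiable everywhere, with
`Dw(s) = −(Dφ_s) ⋆ ∇Γ`, `φ_s = ∇ξ_R · U₀(s)`** ([BT1] proof of Lemma 2.5, the first display for
`∇w`). [cite: BradshawTsai2017AHP, proof of Lemma 2.5 (the bound on ∇w)] -/
theorem hasFDerivAt_profileCorrector {U₀ : ℝ → EuclideanSpace ℝ (Fin 3) → EuclideanSpace ℝ (Fin 3)}
    (hU : ContDiff ℝ 1 (uncurry U₀)) {R : ℝ} (hR : 0 < R) (s : ℝ) (y : EuclideanSpace ℝ (Fin 3)) :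
    HasFDerivAt (profileCorrector R U₀ s)
      (-(fderiv ℝ (fun z => ⟪gradient (cutoffScaled R) z, U₀ s z⟫)
          ⋆[(ContinuousLinearMap.lsmul ℝ ℝ :
            ℝ →L[ℝ] EuclideanSpace ℝ (Fin 3) →L[ℝ] EuclideanSpace ℝ (Fin 3)).precompL
              (EuclideanSpace ℝ (Fin 3)), volume]
        gradient newtonKernel) y) y :=
  hasFDerivAt_gradNewtonPotential
    ((contDiff_cutoffGradDensity hU R).comp (contDiff_prodMk_right s))
    (hasCompactSupport_cutoffGradDensity hR (U₀ s)) y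

/-- **The decay of `∇w`**: if `‖Dφ_s‖ ≤ M` everywhere, then
`‖Dw(s)(y)‖ ≤ A(M, R) (1 + |y|)⁻²` for all `y`, with
`A = max (5Mρ(1 + 2ρ)²) ((4/3)Mρ³(1 + (2ρ)⁻¹)²)`, `ρ = 2R` ([BT1]: "`‖∇w‖_{L^∞(B_{4R₀})} ≤
C(R₀,U₀)`" and decay at infinity). [cite: BradshawTsai2017AHP, proof of Lemma 2.5 (the bound on ∇w)] -/
theorem norm_fderiv_profileCorrector_le
    {U₀ : ℝ → EuclideanSpace ℝ (Fin 3) → EuclideanSpace ℝ (Fin 3)} (hU : ContDiff ℝ 1 (uncurry U₀))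
    {R : ℝ} (hR : 0 < R) {s : ℝ} {M : ℝ}
    (hM : ∀ z, ‖fderiv ℝ (fun z => ⟪gradient (cutoffScaled R) z, U₀ s z⟫) z‖ ≤ M)
    (y : EuclideanSpace ℝ (Fin 3)) :
    ‖fderiv ℝ (profileCorrector R U₀ s) y‖ ≤
      max (5 * M * (2 * R) * (1 + 2 * (2 * R)) ^ 2)
          (4 / 3 * M * (2 * R) ^ 3 * (1 + (2 * (2 * R))⁻¹) ^ 2) * ((1 + ‖y‖) ^ 2)⁻¹ := by
  rw [(hasFDerivAt_profileCorrector hU hR s y).fderiv, norm_neg, convolution_def]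
  exact norm_integral_le_bracket_of_kernel_bound
    (Φ := fun y t => (ContinuousLinearMap.lsmul ℝ ℝ :
        ℝ →L[ℝ] EuclideanSpace ℝ (Fin 3) →L[ℝ] EuclideanSpace ℝ (Fin 3)).precompL
          (EuclideanSpace ℝ (Fin 3))
      (fderiv ℝ (fun z => ⟪gradient (cutoffScaled R) z, U₀ s z⟫) t)
      (gradient newtonKernel (y - t)))
    (by positivity) hM (support_fderiv_cutoffGradDensity_subset hR (U₀ s))
    (fun y t _ => norm_precompL_lsmul_gradient_newtonKernel_le _ y t) y

/-- **`W(s) = ξU₀(s) + w(s)` is differentiable with `DW(s) = D(ξU₀(s)) + Dw(s)`** ([BT1]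
Lemma 2.5: "`W` is locally continuously differentiable in `y`"). [cite: BradshawTsai2017AHP, Lemma 2.5] -/
theorem hasFDerivAt_revisedProfile {U₀ : ℝ → EuclideanSpace ℝ (Fin 3) → EuclideanSpace ℝ (Fin 3)}
    (hU : ContDiff ℝ 1 (uncurry U₀)) {R : ℝ} (hR : 0 < R) (s : ℝ) (y : EuclideanSpace ℝ (Fin 3)) :
    HasFDerivAt (revisedProfile R U₀ s)
      (fderiv ℝ (fun y => cutoffScaled R y • U₀ s y) y +
        fderiv ℝ (profileCorrector R U₀ s) y) y := by
  have hV : HasFDerivAt (fun y => cutoffScaled R y • U₀ s y)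
      (fderiv ℝ (fun y => cutoffScaled R y • U₀ s y) y) y :=
    (hasFDerivAt_timeSlice (contDiff_cutoffScaled_smul hU R) s y).differentiableAt.hasFDerivAt
  have hw : HasFDerivAt (profileCorrector R U₀ s) (fderiv ℝ (profileCorrector R U₀ s) y) y :=
    (hasFDerivAt_profileCorrector hU hR s y).differentiableAt.hasFDerivAt
  exact hV.add hw

/-- **Pointwise bound on `∇U₀(s) − ∇W(s)`**: with `‖DU₀(s)‖ ≤ C₁` and `‖D(ξU₀(s))‖ ≤ C₂` on
`B̄(0, 2R)` and `‖Dφ_s‖ ≤ M`, `‖DU₀(s)(y) − DW(s)(y)‖ ≤ C' (1 + |y|)⁻²` for every `y`, with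
`C' = (C₁ + C₂)(1 + 2R)² + A(M, R)` (`DU₀ − D(ξU₀)` vanishes off the ball, by the triangle
inequality on it). [cite: BradshawTsai2017AHP, proof of Lemma 2.5 (the bound on ∇w)] -/
theorem norm_fderiv_sub_fderiv_revisedProfile_le
    {U₀ : ℝ → EuclideanSpace ℝ (Fin 3) → EuclideanSpace ℝ (Fin 3)} (hU : ContDiff ℝ 1 (uncurry U₀))
    {R : ℝ} (hR : 0 < R) {s : ℝ} {C₁ C₂ M : ℝ}
    (hC₁ : ∀ y ∈ closedBall (0 : EuclideanSpace ℝ (Fin 3)) (2 * R), ‖fderiv ℝ (U₀ s) y‖ ≤ C₁)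
    (hC₂ : ∀ y ∈ closedBall (0 : EuclideanSpace ℝ (Fin 3)) (2 * R),
      ‖fderiv ℝ (fun y => cutoffScaled R y • U₀ s y) y‖ ≤ C₂)
    (hM : ∀ z, ‖fderiv ℝ (fun z => ⟪gradient (cutoffScaled R) z, U₀ s z⟫) z‖ ≤ M)
    (y : EuclideanSpace ℝ (Fin 3)) :
    ‖fderiv ℝ (U₀ s) y - fderiv ℝ (revisedProfile R U₀ s) y‖ ≤
      ((C₁ + C₂) * (1 + 2 * R) ^ 2 +
        max (5 * M * (2 * R) * (1 + 2 * (2 * R)) ^ 2)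
          (4 / 3 * M * (2 * R) ^ 3 * (1 + (2 * (2 * R))⁻¹) ^ 2)) * ((1 + ‖y‖) ^ 2)⁻¹ := by
  have hw := norm_fderiv_profileCorrector_le hU hR hM y
  have hC0 : 0 ≤ C₁ + C₂ :=
    add_nonneg ((norm_nonneg _).trans (hC₁ 0 (mem_closedBall_self (by positivity))))
      ((norm_nonneg _).trans (hC₂ 0 (mem_closedBall_self (by positivity))))
  have hVpart : ‖fderiv ℝ (U₀ s) y - fderiv ℝ (fun y => cutoffScaled R y • U₀ s y) y‖ ≤
      (C₁ + C₂) * (1 + 2 * R) ^ 2 * ((1 + ‖y‖) ^ 2)⁻¹ := by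
    by_cases hy : y ∈ closedBall (0 : EuclideanSpace ℝ (Fin 3)) (2 * R)
    · have h1 : ‖fderiv ℝ (U₀ s) y - fderiv ℝ (fun y => cutoffScaled R y • U₀ s y) y‖ ≤
          C₁ + C₂ := (norm_sub_le _ _).trans (add_le_add (hC₁ y hy) (hC₂ y hy))
      have key : (1 : ℝ) ≤ (1 + 2 * R) ^ 2 * ((1 + ‖y‖) ^ 2)⁻¹ := by
        rw [mem_closedBall, dist_zero_right] at hy
        rw [← div_eq_mul_inv, one_le_div (by positivity)]
        exact pow_le_pow_left₀ (by positivity) (by linarith) 2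
      calc ‖fderiv ℝ (U₀ s) y - fderiv ℝ (fun y => cutoffScaled R y • U₀ s y) y‖
          ≤ (C₁ + C₂) * 1 := by rw [mul_one]; exact h1
        _ ≤ (C₁ + C₂) * ((1 + 2 * R) ^ 2 * ((1 + ‖y‖) ^ 2)⁻¹) :=
            mul_le_mul_of_nonneg_left key hC0
        _ = (C₁ + C₂) * (1 + 2 * R) ^ 2 * ((1 + ‖y‖) ^ 2)⁻¹ := by ring
    · rw [mem_closedBall, dist_zero_right, not_le] at hy
      rw [fderiv_cutoffScaled_smul_eq hR (U₀ s) hy, sub_self, norm_zero]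
      positivity
  rw [(hasFDerivAt_revisedProfile hU hR s y).fderiv, sub_add_eq_sub_sub]
  calc ‖fderiv ℝ (U₀ s) y - fderiv ℝ (fun y => cutoffScaled R y • U₀ s y) y -
        fderiv ℝ (profileCorrector R U₀ s) y‖
      ≤ ‖fderiv ℝ (U₀ s) y - fderiv ℝ (fun y => cutoffScaled R y • U₀ s y) y‖ +
        ‖fderiv ℝ (profileCorrector R U₀ s) y‖ := norm_sub_le _ _
    _ ≤ (C₁ + C₂) * (1 + 2 * R) ^ 2 * ((1 + ‖y‖) ^ 2)⁻¹ +
        max (5 * M * (2 * R) * (1 + 2 * (2 * R)) ^ 2)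
          (4 / 3 * M * (2 * R) ^ 3 * (1 + (2 * (2 * R))⁻¹) ^ 2) * ((1 + ‖y‖) ^ 2)⁻¹ :=
        add_le_add hVpart hw
    _ = _ := by ring

/-- **The `L²` bound for one slice**: under the hypotheses of
`norm_fderiv_sub_fderiv_revisedProfile_le`,
`∫ |∇U₀(s) − ∇W(s)|² ≤ 3C'² ∫ (1 + |y|)⁻⁴ dy` (`|L|² ≤ 3‖L‖²`; the right-hand side is finite,
`3 < 4`). [cite: BradshawTsai2017AHP, proof of Lemma 2.5 (the bound on ∇w)] -/
theorem lintegral_frobeniusNormSq_fderiv_sub_le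
    {U₀ : ℝ → EuclideanSpace ℝ (Fin 3) → EuclideanSpace ℝ (Fin 3)} (hU : ContDiff ℝ 1 (uncurry U₀))
    {R : ℝ} (hR : 0 < R) {s : ℝ} {C₁ C₂ M : ℝ}
    (hC₁ : ∀ y ∈ closedBall (0 : EuclideanSpace ℝ (Fin 3)) (2 * R), ‖fderiv ℝ (U₀ s) y‖ ≤ C₁)
    (hC₂ : ∀ y ∈ closedBall (0 : EuclideanSpace ℝ (Fin 3)) (2 * R),
      ‖fderiv ℝ (fun y => cutoffScaled R y • U₀ s y) y‖ ≤ C₂)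
    (hM : ∀ z, ‖fderiv ℝ (fun z => ⟪gradient (cutoffScaled R) z, U₀ s z⟫) z‖ ≤ M) :
    ∫⁻ y, ENNReal.ofReal (frobeniusNormSq
        (fderiv ℝ (U₀ s) y - fderiv ℝ (revisedProfile R U₀ s) y)) ≤
      ENNReal.ofReal (3 * ((C₁ + C₂) * (1 + 2 * R) ^ 2 +
        max (5 * M * (2 * R) * (1 + 2 * (2 * R)) ^ 2)
          (4 / 3 * M * (2 * R) ^ 3 * (1 + (2 * (2 * R))⁻¹) ^ 2)) ^ 2) *
        ∫⁻ y : EuclideanSpace ℝ (Fin 3), ENNReal.ofReal ((1 + ‖y‖) ^ (-(4 : ℝ))) := by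
  set C' : ℝ := (C₁ + C₂) * (1 + 2 * R) ^ 2 +
    max (5 * M * (2 * R) * (1 + 2 * (2 * R)) ^ 2)
      (4 / 3 * M * (2 * R) ^ 3 * (1 + (2 * (2 * R))⁻¹) ^ 2) with hC'
  have hpt : ∀ y, ENNReal.ofReal (frobeniusNormSq
      (fderiv ℝ (U₀ s) y - fderiv ℝ (revisedProfile R U₀ s) y)) ≤
      ENNReal.ofReal (3 * C' ^ 2) * ENNReal.ofReal ((1 + ‖y‖) ^ (-(4 : ℝ))) := by
    intro y
    have h1 := norm_fderiv_sub_fderiv_revisedProfile_le hU hR hC₁ hC₂ hM y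
    rw [← hC'] at h1
    have h3 : (C' * ((1 + ‖y‖) ^ 2)⁻¹) ^ 2 = C' ^ 2 * (1 + ‖y‖) ^ (-(4 : ℝ)) := by
      rw [Real.rpow_neg (by positivity), show (4 : ℝ) = ((4 : ℕ) : ℝ) by norm_num,
        Real.rpow_natCast]
      field_simp
    have h2 : frobeniusNormSq (fderiv ℝ (U₀ s) y - fderiv ℝ (revisedProfile R U₀ s) y) ≤
        3 * C' ^ 2 * (1 + ‖y‖) ^ (-(4 : ℝ)) :=
      calc frobeniusNormSq (fderiv ℝ (U₀ s) y - fderiv ℝ (revisedProfile R U₀ s) y)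
          ≤ 3 * ‖fderiv ℝ (U₀ s) y - fderiv ℝ (revisedProfile R U₀ s) y‖ ^ 2 :=
            frobeniusNormSq_le_three_mul_norm_sq _
        _ ≤ 3 * (C' * ((1 + ‖y‖) ^ 2)⁻¹) ^ 2 :=
            mul_le_mul_of_nonneg_left (pow_le_pow_left₀ (norm_nonneg _) h1 2) (by norm_num)
        _ = 3 * C' ^ 2 * (1 + ‖y‖) ^ (-(4 : ℝ)) := by rw [h3, mul_assoc]
    calc ENNReal.ofReal (frobeniusNormSq
          (fderiv ℝ (U₀ s) y - fderiv ℝ (revisedProfile R U₀ s) y))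
        ≤ ENNReal.ofReal (3 * C' ^ 2 * (1 + ‖y‖) ^ (-(4 : ℝ))) := ENNReal.ofReal_le_ofReal h2
      _ = _ := ENNReal.ofReal_mul (by positivity)
  refine (lintegral_mono hpt).trans ?_
  rw [lintegral_const_mul' _ _ ENNReal.ofReal_ne_top]

/-! ### The discharge -/

/-- **[BT1] proof of Lemma 2.5, the gradient bound `∇(U₀ − W) ∈ L^∞(0,T;L²)`: discharge of
`bradshawTsai2017_lemma_2_5_gradient`.** For `U₀` under Assumption 2.1 (any `q`) and any
`R₀ ≥ 1`, `sup_s ∫ |∇U₀(s) − ∇(revisedProfile R₀ U₀)(s)|² < ∞`. Proof: by `T`-periodicity of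
`U₀` every slice is a slice with `s ∈ [0,T)`; on the compact `[0,T] × B̄(0, 2R₀)` the continuous
derivatives `DU₀`, `D(ξU₀)`, `D(∇ξ·U₀)` are bounded ("since `U₀` is continuously differentiable
we have `‖∇U₀‖_{L^∞(B_{2R₀})} < ∞`"), `D(∇ξ·U₀(s))` vanishes off the ball, and
`lintegral_frobeniusNormSq_fderiv_sub_le` bounds every slice integral by the same finite
`3C'² ∫ (1 + |y|)⁻⁴ dy`. [cite: BradshawTsai2017AHP, proof of Lemma 2.5 (the bound on ∇w)] -/
theorem _root_.Literature.Analysis.FluidPDE.bradshawTsai2017_lemma_2_5_gradient_holds :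
    bradshawTsai2017_lemma_2_5_gradient := by
  intro T hT q _hq U₀ hU₀ R₀ hR₀
  have hR : 0 < R₀ := one_pos.trans_le hR₀
  have hK : IsCompact (Icc 0 T ×ˢ closedBall (0 : EuclideanSpace ℝ (Fin 3)) (2 * R₀)) :=
    isCompact_Icc.prod (isCompact_closedBall _ _)
  have h1 : ContDiff ℝ 1 (uncurry U₀) := hU₀.contDiff
  have h2 := contDiff_cutoffScaled_smul h1 R₀
  have h3 := contDiff_cutoffGradDensity h1 R₀
  obtain ⟨C₁, hC₁⟩ :=
    hK.exists_bound_of_continuousOn (h1.continuous_fderiv one_ne_zero).continuousOn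
  obtain ⟨C₂, hC₂⟩ :=
    hK.exists_bound_of_continuousOn (h2.continuous_fderiv one_ne_zero).continuousOn
  obtain ⟨M, hM⟩ :=
    hK.exists_bound_of_continuousOn (h3.continuous_fderiv one_ne_zero).continuousOn
  have hM0 : 0 ≤ M :=
    (norm_nonneg _).trans (hM (0, 0) ⟨⟨le_rfl, hT.le⟩, mem_closedBall_self (by positivity)⟩)
  set B : ℝ≥0∞ := ENNReal.ofReal (3 * ((C₁ + C₂) * (1 + 2 * R₀) ^ 2 +
      max (5 * M * (2 * R₀) * (1 + 2 * (2 * R₀)) ^ 2)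
        (4 / 3 * M * (2 * R₀) ^ 3 * (1 + (2 * (2 * R₀))⁻¹) ^ 2)) ^ 2) *
    ∫⁻ y : EuclideanSpace ℝ (Fin 3), ENNReal.ofReal ((1 + ‖y‖) ^ (-(4 : ℝ))) with hB
  have hBtop : B < ∞ :=
    ENNReal.mul_lt_top ENNReal.ofReal_lt_top
      (finite_integral_one_add_norm (by rw [finrank_euclideanSpace_fin]; norm_num))
  refine lt_of_le_of_lt (iSup_le fun s => ?_) hBtop
  -- reduce to a slice `s' ∈ [0, T)` by periodicity
  have hper : Function.Periodic U₀ T := fun s => funext (hU₀.periodic s)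
  obtain ⟨s', hs', hss'⟩ := hper.exists_mem_Ico₀ hT s
  have hW : revisedProfile R₀ U₀ s = revisedProfile R₀ U₀ s' := by
    funext y
    simp only [revisedProfile, profileCorrector, hss']
  have hslice : ∀ y, fderiv ℝ (U₀ s) y - fderiv ℝ (revisedProfile R₀ U₀ s) y =
      fderiv ℝ (U₀ s') y - fderiv ℝ (revisedProfile R₀ U₀ s') y := fun y => by
    rw [hW, hss']
  simp_rw [hslice]
  have hs'' : s' ∈ Icc 0 T := Ico_subset_Icc_self hs'
  refine lintegral_frobeniusNormSq_fderiv_sub_le h1 hR (s := s') (fun y hy => ?_)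
    (fun y hy => ?_) (fun z => ?_)
  · exact (norm_fderiv_timeSlice_le h1 s' y).trans (hC₁ (s', y) ⟨hs'', hy⟩)
  · exact (norm_fderiv_timeSlice_le h2 s' y).trans (hC₂ (s', y) ⟨hs'', hy⟩)
  · by_cases hz : z ∈ closedBall (0 : EuclideanSpace ℝ (Fin 3)) (2 * R₀)
    · exact (norm_fderiv_timeSlice_le h3 s' z).trans (hM (s', z) ⟨hs'', hz⟩)
    · rw [mem_closedBall, dist_zero_right, not_le] at hz
      rw [fderiv_cutoffGradDensity_eq_zero hR (U₀ s') hz, norm_zero]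
      exact hM0

end BradshawTsai2017

end Literature.Analysis.FluidPDE

end
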